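import Summits.BirchSwinnertonDyer.Rank1Residual.Additive.DefectCountFiniteLevelOfFacts
import Summits.BirchSwinnertonDyer.Rank1Residual.GaloisImage.PropagatedConditionCount
import Literature.NumberTheory.EllipticCurves.CongruenceVisibilityLocalFactors
import Literature.NumberTheory.EllipticCurves.TorsionFrobeniusProofs
import HarnessLib

/-!
# `#(𝓞_v ⧸ p^m) = p^m` for the place `v` of `ℚ` above `p`, and the count (C) at finite level over
# `ℚ` with the hypothesis `#(𝓞_{v₀}/p^m) = p^m` DISCHARGED (cell `b2b-bsdres`, CLASS-CLOSURE lane,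
# class O10 — x1b GEN 38, class lead; file 70 of the series)

HONEST FRAMING (cell `b2b-bsdres`, run/shared/lean/b2b/bsd-rank1-residual/, verbatim in every
file): the goal of the cell is to DELETE the COMBINATION-SHAPED residual classes of the
Birch–Swinnerton-Dyer formula for ALL analytic-rank `≤ 1` elliptic curves over `ℚ` — "full BSD
formula for every rank `≤ 1` curve in class `C`" assembled STRICTLY from published theorems — so
that the rank-`≤ 1` remainder becomes exactly the CONSTRUCTION-SHAPED classes, which are TYPED
(missing-input `Prop`s), NOT attempted. This is not "finishing BSD". CLASS-CLOSURE lane: prove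
what is provable now; shrink each hard class to its core with data; no claim beyond stated classes;
research routes on CONSTRUCTION-SHAPED X12 / O10; census / instrument output = EVIDENCE / conjecture
items, NEVER a Literature fact; `RESIDUAL-MAP.md` marks change only by signed lines. THIS FILE:
TOOL THEOREMS ONLY — no definition, no named Literature fact, no Summits-side fact `def … : Prop`,
no `sorry`, axioms standard; nothing is booked; no label / mark / count / sub-cell moves; (C1_η),
(C2_η-GZ), (C3_η) stay typed as filed (cc-typer-6's pen); O10 stays OPEN / CONSTRUCTION-SHAPED;
nothing about `BSD(W, p)` of any pair is claimed.

## What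

File 69 (`relIndex_mul_prime_pow_eq_of_rankOne_of_facts`) carries the hypothesis
`hOv : #(𝓞_{w₀} ⧸ p^m) = p^m` for the adic integers at the distinguished finite place `w₀`.  Over
`K = ℚ` with `w₀ = v₀` the place above `p` this is a theorem:

* `natCard_quotient_span_singleton_pow` — `#(R ⧸ a^m) = #(R ⧸ a)^m` for `a ≠ 0` in a domain
  (iterate the tree's `natCard_quotient_span_singleton_mul'`);
* `natCard_quot_adicCompletionIntegers_natCast_pow` — `#(𝓞_v ⧸ n^m) = #(𝓞_v ⧸ n)^m` at any finite
  place of any number field, `n ≠ 0`;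
* `natCard_quot_adicCompletionIntegers_prime_pow_rat` — **`#(𝓞_v ⧸ p^m) = p^m`** for the place `v`
  of `ℚ` with `primesEquiv v = p` (`∏_{v ∣ p} #(𝓞_v/p) = p^{[K:ℚ]}`, tree
  `prod_natCard_quot_adicCompletionIntegers`, at `K = ℚ`);
* `relIndex_mul_prime_pow_eq_of_rankOne_of_facts_rat` — file 69 over `ℚ` at the place above `p`,
  `hOv` discharged: the count
  **`[H¹_𝓖 : H¹_{𝓚[v₀ ↦ 0]}] · p^{m−t−ν} = #(p^t·C) · ∏_{ℓ ∈ T} [𝓖_ℓ : 𝓚_ℓ]`** under the two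
  fact-shaped hypotheses (a Poitou–Tate family injective at the real place; Tate's local Euler
  characteristic) and (MW), (Ш), (Γ), (loc), (span), (kill).

References: [GreenbergLNM1716] §4; [MilneADT2006] I Lemma 3.3, Thm. 2.8; Neukirch, *ANT* II (8.4).
-/

noncomputable section

open scoped Classical

open CategoryTheory Field Function NumberField IsDedekindDomain WeierstrassCurve
open Literature.NumberTheory.EllipticCurves
open Literature.NumberTheory.GaloisRepresentations
open Literature.NumberTheory.GaloisRepresentations.DiscreteGaloisModule (SelmerStructure)
open Literature.NumberTheory.GaloisCohomology

namespace Summit.BirchSwinnertonDyer.Rank1Residual.Additive.DefectCountFiniteLevel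

/-! ## §1 `#(R ⧸ a^m) = #(R ⧸ a)^m` and `#(𝓞_v ⧸ p^m) = p^m` over `ℚ` -/

/-- `#(R ⧸ (a^m)) = #(R ⧸ (a))^m` for `a ≠ 0` in a domain (the filtration
`R ⊇ (a) ⊇ (a²) ⊇ ⋯` has graded pieces `≅ R/(a)`; iterate `natCard_quotient_span_singleton_mul'`).
[folklore] -/
theorem natCard_quotient_span_singleton_pow {R : Type*} [CommRing R] [IsDomain R] {a : R}
    (ha : a ≠ 0) (m : ℕ) :
    Nat.card (R ⧸ Ideal.span {a ^ m}) = Nat.card (R ⧸ Ideal.span {a}) ^ m := by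
  induction m with
  | zero =>
    rw [pow_zero, pow_zero, Ideal.span_singleton_one]
    haveI : Subsingleton (R ⧸ (⊤ : Ideal R)) := Ideal.Quotient.subsingleton_iff.mpr rfl
    exact Nat.card_of_subsingleton 0
  | succ m ih =>
    rw [pow_succ', GaloisImage.natCard_quotient_span_singleton_mul' ha, ih, pow_succ']

/-- `#(𝓞_v ⧸ n^m) = #(𝓞_v ⧸ n)^m` for the `v`-adic integers of a number field and `n ≠ 0`.
[folklore] -/
theorem natCard_quot_adicCompletionIntegers_natCast_pow {K : Type*} [Field K] [NumberField K]
    (v : HeightOneSpectrum (𝓞 K)) {n : ℕ} (hn : n ≠ 0) (m : ℕ) :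
    Nat.card (v.adicCompletionIntegers K ⧸
        Ideal.span {((n ^ m : ℕ) : v.adicCompletionIntegers K)}) =
      Nat.card (v.adicCompletionIntegers K ⧸ Ideal.span {(n : v.adicCompletionIntegers K)}) ^ m := by
  rw [Nat.cast_pow]
  exact natCard_quotient_span_singleton_pow (LocalPoints.natCast_ne_zero v hn) m

/-- **`#(ℤ_p ⧸ p^m ℤ_p) = p^m`** for the `v`-adic integers at the place `v` of `ℚ` above `p`
(`primesEquiv v = p`): `#(𝓞_v/p) = p^{[ℚ:ℚ]} = p` (tree `prod_natCard_quot_adicCompletionIntegers`,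
Neukirch *ANT* II (8.4)) and `#(𝓞_v/p^m) = #(𝓞_v/p)^m`. [folklore] -/
theorem natCard_quot_adicCompletionIntegers_prime_pow_rat {p : ℕ} [hp : Fact p.Prime]
    {v : HeightOneSpectrum (𝓞 ℚ)} (hv : (Rat.HeightOneSpectrum.primesEquiv v : ℕ) = p) (m : ℕ) :
    Nat.card (v.adicCompletionIntegers ℚ ⧸
        Ideal.span {((p ^ m : ℕ) : v.adicCompletionIntegers ℚ)}) = p ^ m := by
  rw [natCard_quot_adicCompletionIntegers_natCast_pow v hp.out.ne_zero m]
  congr 1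
  have h := prod_natCard_quot_adicCompletionIntegers (K := ℚ) (p := p) {v} (fun w hw hpw ↦ hw ?_)
  · rw [Finset.prod_singleton, Module.finrank_self, pow_one] at h
    exact h
  · rw [Finset.mem_singleton]
    apply (Rat.HeightOneSpectrum.primesEquiv (R := 𝓞 ℚ)).injective
    apply Subtype.ext
    rw [primesEquiv_eq_of_natCast_mem hp.out hpw, hv]

/-! ## §2 The count (C) at finite level over `ℚ`, `#(𝓞_{v₀}/p^m) = p^m` discharged -/

/-- **THE COUNT (C) AT FINITE LEVEL OVER `ℚ` FROM RANK-ONE INPUTS AND THE NAMED FACTS**, at the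
place `v₀` of `ℚ` above `p` (`primesEquiv v₀ = p`; the group law on `E(ℚ)` with Mathlib's `instDecidableEqRat`): file 69's
`relIndex_mul_prime_pow_eq_of_rankOne_of_facts` with `K = ℚ`, `w₀ = v₀` and the hypothesis
`#(𝓞_{v₀} ⧸ p^m) = p^m` DISCHARGED (`natCard_quot_adicCompletionIntegers_prime_pow_rat`).  Remaining
hypotheses: a family `inv` of local invariant maps at level `p^m` with `IsPerfect`,
`SumLocalTermEqZero`, `SelmerComplement`, injective at the real place; Tate's local Euler
characteristic at the finite places; and (MW) `P` generates `E(ℚ)/p^m` with order `p^m`, (Ш)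
`Ш[p^m] ⊆ Ш[p^e]`, (Γ) `E[p^∞]^{Γ_ℚ} = 0`, (loc) no `p`-torsion in `E(ℚ_p)` and `P = p^ν Q` of exact
level `ν` there, (span) `C ⊔ 𝓚_p = ⊤`, (kill) `p^{m−t−ν} 𝓚_{m,ℓ} = 0` (`ℓ ∈ T`), `ν + e ≤ t`,
`t + ν ≤ m`.  THEN **`[H¹_𝓖 : H¹_{𝓚[v₀ ↦ 0]}] · p^{m−t−ν} = #(p^t·C) · ∏_{ℓ ∈ T} [𝓖_ℓ : 𝓚_ℓ]`**
for `𝓖 = 𝓚[v₀ ↦ p^t·C][ℓ ↦ 𝓖_ℓ ⊇ 𝓚_ℓ (ℓ ∈ T)]`.  CONDITIONAL on the listed hypotheses; nothing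
booked. [cite: GreenbergLNM1716, §4 (pp. 98–103)]
[cite: Howard2004HeegnerKolyvagin, Thm. 2.1.11 (arXiv:1202.6340 p. 6)]
[cite: MilneADT2006, Ch. I, Thm. 2.8, Lemma 3.3 and Thm. 4.10] -/
theorem relIndex_mul_prime_pow_eq_of_rankOne_of_facts_rat (W : WeierstrassCurve ℚ) [W.IsElliptic]
    {p m : ℕ} [hp : Fact p.Prime] (hm : 1 ≤ m)
    (inv : LocalInvariants ℚ (p ^ m)) (hperf : inv.IsPerfect) (hvan : inv.SumLocalTermEqZero)
    (hcomp : inv.SelmerComplement)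
    (hreal : ∀ w : InfinitePlace ℚ, w.IsReal → Injective (inv (Sum.inl w)))
    (hEP : ∀ v : HeightOneSpectrum (𝓞 ℚ), localEulerPoincareCharacteristic (v.adicCompletion ℚ))
    (v₀ : HeightOneSpectrum (𝓞 ℚ)) (hv₀ : (Rat.HeightOneSpectrum.primesEquiv v₀ : ℕ) = p)
    (T : Finset (HeightOneSpectrum (𝓞 ℚ))) (hv₀T : v₀ ∉ T)
    (C : AddSubgroup (galoisCohomology ((W.torsionGaloisModule (p ^ m)).toLocal (Sum.inr v₀)) 1))
    {t ν eSha : ℕ} (𝓖 : SelmerStructure (W.torsionGaloisModule (p ^ m)))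
    (h𝓖v₀ : 𝓖 (Sum.inr v₀) = C.map (nsmulAddMonoidHom (p ^ t)))
    (h𝓖T : ∀ w ∈ T, W.kummerSelmerStructure ((p ^ m : ℕ) : ℤ) (Sum.inr w) ≤ 𝓖 (Sum.inr w))
    (h𝓖off : ∀ v : Place ℚ, v ≠ Sum.inr v₀ → (∀ w ∈ T, v ≠ Sum.inr w) →
      𝓖 v = W.kummerSelmerStructure ((p ^ m : ℕ) : ℤ) v)
    -- (MW)
    (hdiv : W.zsmul_geomPoints_surjective) (P : W.toAffine.Point)
    (hgen : ∀ Q : W.toAffine.Point, ∃ a : ℤ,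
      Q - a • P ∈ (zsmulAddGroupHom ((p ^ m : ℕ) : ℤ) : W.toAffine.Point →+ _).range)
    (hord : ∀ a : ℤ, a • P ∈ (zsmulAddGroupHom ((p ^ m : ℕ) : ℤ) : W.toAffine.Point →+ _).range →
      ((p ^ m : ℕ) : ℤ) ∣ a)
    -- (Ш)
    (hSha : ∀ c ∈ W.sha, ((p ^ m : ℕ) : ℤ) • c = 0 → p ^ eSha • c = 0)
    -- (Γ)
    (hΓ : ∀ Q : W.geomPrimaryTorsion p,
      (∀ σ : absoluteGaloisGroup ℚ, X11b.LocBridge.primaryGaloisModule W p σ Q = Q) → Q = 0)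
    -- (loc) at `v₀`
    (htors : ∀ X : (W.baseChange (Place.Completion (Sum.inr v₀ : Place ℚ))).toAffine.Point,
      p • X = 0 → X = 0)
    {Qv : (W.baseChange (Place.Completion (Sum.inr v₀ : Place ℚ))).toAffine.Point}
    (hPQ : p ^ ν • Qv = Affine.Point.baseChange (W' := W) ℚ (Place.Completion (Sum.inr v₀ : Place ℚ)) P)
    (hexact : ∀ Q' : (W.baseChange (Place.Completion (Sum.inr v₀ : Place ℚ))).toAffine.Point,
      p ^ (ν + 1) • Q' ≠ Affine.Point.baseChange (W' := W) ℚ (Place.Completion (Sum.inr v₀ : Place ℚ)) P)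
    -- (span) at `v₀`
    (hCL : C ⊔ W.kummerSelmerStructure ((p ^ m : ℕ) : ℤ) (Sum.inr v₀) = ⊤)
    -- (kill) at `ℓ ∈ T`
    (hkill : ∀ w ∈ T, ∀ x ∈ W.kummerSelmerStructure ((p ^ m : ℕ) : ℤ) (Sum.inr w),
      p ^ (m - t - ν) • x = 0)
    (het : ν + eSha ≤ t) (htν : t + ν ≤ m) :
    (SelmerStructure.selmerGroup (Function.update (W.kummerSelmerStructure ((p ^ m : ℕ) : ℤ))
          (Sum.inr v₀) ⊥ : SelmerStructure (W.torsionGaloisModule (p ^ m)))).relIndex 𝓖.selmerGroup *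
        p ^ (m - t - ν) =
      Nat.card (C.map (nsmulAddMonoidHom (p ^ t))) *
        ∏ w ∈ T, (W.kummerSelmerStructure ((p ^ m : ℕ) : ℤ) (Sum.inr w)).relIndex (𝓖 (Sum.inr w)) := by
  haveI : CharZero (Place.Completion (Sum.inr v₀ : Place ℚ)) :=
    Literature.NumberTheory.GaloisRepresentations.charZero_adicCompletion v₀
  -- the general-`K` file 69 carries the classical `DecidableEq K` inside the group law of
  -- `W.toAffine.Point`; over `ℚ` the binders above carry Mathlib's `instDecidableEqRat`
  -- (transport along `Subsingleton.elim`, as in `X12/CMModPCriterion`)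
  have hinst : (instDecidableEqRat : DecidableEq ℚ) = fun a b => Classical.propDecidable (a = b) :=
    Subsingleton.elim _ _
  rw [hinst] at hgen hord
  exact relIndex_mul_prime_pow_eq_of_rankOne_of_facts W hm inv hperf hvan hcomp hreal hEP v₀
    (natCard_quot_adicCompletionIntegers_prime_pow_rat hv₀ m) T hv₀T C 𝓖 h𝓖v₀ h𝓖T h𝓖off hdiv P
    hgen hord hSha hΓ htors hPQ hexact hCL hkill het htν

end Summit.BirchSwinnertonDyer.Rank1Residual.Additive.DefectCountFiniteLevel

end
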